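import Summits.CriticalPhenomena.PercolationContinuityZ3.Theorems.PercNearOneGluingNoHeavyLowerTailSahiE3MajCertB1
import Summits.CriticalPhenomena.PercolationContinuityZ3.Theorems.PercNearOneGluingNoHeavyLowerTailSahiE3MajCertB2
import Mathlib.Data.Real.Basic
import Mathlib.Tactic.Linarith
import Mathlib.Tactic.Positivity
import Mathlib.Tactic.FieldSimp
import HarnessLib
import HarnessLib.Audit

/-!
# `NoHeavyLowerTail` (crux stmt-CriticalPhenomena-4575), Sahi programme P4 (Holley / monotone coupling):
# the maj-slot certificate on the pattern `2³` — VII: regimes B1 and B2(k) as existence statements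

Support file (cell `prim-l12`, seat P4, generation 9; `--supports stmt-CriticalPhenomena-4575`).  No named facts, no
sorries; standard axioms; pure real algebra.  The proofs are machine-found certificates: every item is closed by `linarith` from an
explicit nonnegative combination of the listed facts (an exact rational Positivstellensatz-type certificate found by linear
programming over products of the facts with nonnegative aggregate masses, verified in exact arithmetic before emission; generator
and certificates in HOME prim-l12-p4/code/gen9, memo FROM-prim-l12-p4-gen9-MAJ-SLOT-LEAN.md).

Setting (memo HOME prim-l12-p4/FROM-prim-l12-p4-gen8-PATTERN-CERTIFICATES.md §4b): the pattern `2³` of three join-primes with the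
majority slot `MAJ = {ij, ik, jk, ⊤}`; for a labelling `(i, j, k)` of the atoms the eight fibre masses are `nE, ni, nj, nk, nij,
nik, njk, nT` with total `Z` (kept as a symbol; `d = nE+ni+nj+nk`, `u = nij+nik+njk+nT`, NOT normalised); the hypotheses are
consequences of log-supermodularity of the pattern measure (`…SahiE3MajPatternFacts.facts_of_pattern`); the conclusions are the
validity / up-transport / pair inequalities for retained masses `rij, rik, rjk, rT` (homogeneous of degree three) consumed by
`…SahiE3MajPattern.certificate_of_ineqs`.  Regimes: A (top full, uniform rank-2 fill), A'(k) (top full, Hall(k) tight), B1 (top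
only), B2(k) (donors of k drained) — HOME memo §4b; the case analysis is `…SahiE3MajCore.exists_cert`.
-/

namespace Summit.CriticalPhenomena.PercolationContinuityZ3.Theorems.SahiE3MajCert

/-- **Regime B1** (top only: `r = (0, 0, 0, Z²u)`), valid when `Z·N₂ ≤ d·n_⊤` and `u(Z + n_x) ≤ (Z+d)·B_x` for the
        three atoms. [this work] -/
theorem cert_B1 (nE ni nj nk nij nik njk nT Z : ℝ)
    (h_nn_E : 0 ≤ nE) (h_nn_0 : 0 ≤ ni) (h_nn_1 : 0 ≤ nj) (h_nn_2 : 0 ≤ nk) (h_nn_01 : 0 ≤ nij) (h_nn_02 : 0 ≤ nik)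
    (h_nn_12 : 0 ≤ njk) (h_nn_T : 0 ≤ nT) (h_nn_Z : 0 ≤ Z) (h_sum : Z = nE + ni + nj + nk + nij + nik + njk + nT)
    (hN2 : Z * (nij + nik + njk) ≤ (nE + ni + nj + nk) * nT)
    (hB_i : (nij + nik + njk + nT) * (Z + ni) ≤ (Z + (nE + ni + nj + nk)) * (nij + nik + nT))
    (hB_j : (nij + nik + njk + nT) * (Z + nj) ≤ (Z + (nE + ni + nj + nk)) * (nij + njk + nT))
    (hB_k : (nij + nik + njk + nT) * (Z + nk) ≤ (Z + (nE + ni + nj + nk)) * (nik + njk + nT)) :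
    ∃ rij rik rjk rT : ℝ,
      0 ≤ rij ∧
      0 ≤ rik ∧
      0 ≤ rjk ∧
      0 ≤ rT ∧
      rij ≤ Z * (Z + (nE + ni + nj + nk)) * nij ∧
              rik ≤ Z * (Z + (nE + ni + nj + nk)) * nik ∧
      rjk ≤ Z * (Z + (nE + ni + nj + nk)) * njk ∧
              rT ≤ Z * (Z + (nE + ni + nj + nk)) * nT ∧
      Z * (nij + nik + njk + nT) * ni ≤
              (Z * (Z + (nE + ni + nj + nk)) * nij - rij) + (Z * (Z + (nE + ni + nj + nk)) * nik - rik) +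
              (Z * (Z + (nE + ni + nj + nk)) * nT - rT) ∧
      Z * (nij + nik + njk + nT) * nj ≤
              (Z * (Z + (nE + ni + nj + nk)) * nij - rij) + (Z * (Z + (nE + ni + nj + nk)) * njk - rjk) +
              (Z * (Z + (nE + ni + nj + nk)) * nT - rT) ∧
      Z * (nij + nik + njk + nT) * nk ≤
              (Z * (Z + (nE + ni + nj + nk)) * nik - rik) + (Z * (Z + (nE + ni + nj + nk)) * njk - rjk) +
              (Z * (Z + (nE + ni + nj + nk)) * nT - rT) ∧
      rij + rik + rjk + rT = Z * Z *
              (nij + nik + njk + nT) ∧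
      Z * Z * nT ≤ rT ∧
      Z * Z * (nij + nT) ≤ rij + rT ∧
      Z * Z *
              (nik + nT) ≤ rik + rT ∧
      Z * Z * (njk + nT) ≤ rjk + rT ∧
      Z * Z * (nij + nik + nT) ≤ rij +
              rik + rT ∧
      Z * Z * (nij + njk + nT) ≤ rij + rjk + rT ∧
      Z * Z * (nik + njk + nT) ≤ rik +
              rjk + rT ∧
      Z * ((nij + nT) * (nik + nT) + (nik + nT) * (nij + nT)) - (nij + nik + njk + nT) *
              (nij + nT) * (nik + nT) ≤ rT ∧
      Z * ((nij + nT) * (njk + nT) + (njk + nT) * (nij + nT)) -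
              (nij + nik + njk + nT) * (nij + nT) * (njk + nT) ≤ rT ∧
      Z *
              ((nik + nT) * (njk + nT) + (njk + nT) * (nik + nT)) - (nij + nik + njk + nT) * (nik + nT) *
              (njk + nT) ≤ rT ∧
      Z * ((nij + nT) * (nik + njk + nT) + (nk + nik + njk + nT) * (nij + nT)) -
              (nij + nik + njk + nT) * (nij + nT) * (nk + nik + njk + nT) ≤ rT ∧
      Z *
              ((nik + nT) * (nij + njk + nT) + (nj + nij + njk + nT) * (nik + nT)) - (nij + nik + njk + nT) *
              (nik + nT) * (nj + nij + njk + nT) ≤ rT ∧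
      Z *
              ((njk + nT) * (nij + nik + nT) + (ni + nij + nik + nT) * (njk + nT)) - (nij + nik + njk + nT) *
              (njk + nT) * (ni + nij + nik + nT) ≤ rT ∧
      Z *
              ((ni + nij + nik + nT) * (nij + nik + nT) + (ni + nij + nik + nT) * (nij + nik + nT)) -
              (nij + nik + njk + nT) * (ni + nij + nik + nT) * (ni + nij + nik + nT) ≤ rij + rik + rT ∧
      Z *
              ((nj + nij + njk + nT) * (nij + njk + nT) + (nj + nij + njk + nT) * (nij + njk + nT)) -
              (nij + nik + njk + nT) * (nj + nij + njk + nT) * (nj + nij + njk + nT) ≤ rij + rjk + rT ∧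
      Z *
              ((nk + nik + njk + nT) * (nik + njk + nT) + (nk + nik + njk + nT) * (nik + njk + nT)) -
              (nij + nik + njk + nT) * (nk + nik + njk + nT) * (nk + nik + njk + nT) ≤ rik + rjk + rT ∧
      Z *
              ((ni + nij + nik + nT) * (nij + njk + nT) + (nj + nij + njk + nT) * (nij + nik + nT)) -
              (nij + nik + njk + nT) * (ni + nij + nik + nT) * (nj + nij + njk + nT) ≤ rij + rT ∧
      Z *
              ((ni + nij + nik + nT) * (nik + njk + nT) + (nk + nik + njk + nT) * (nij + nik + nT)) -
              (nij + nik + njk + nT) * (ni + nij + nik + nT) * (nk + nik + njk + nT) ≤ rik + rT ∧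
      Z *
              ((nj + nij + njk + nT) * (nik + njk + nT) + (nk + nik + njk + nT) * (nij + njk + nT)) -
              (nij + nik + njk + nT) * (nj + nij + njk + nT) * (nk + nik + njk + nT) ≤ rjk + rT := by
  obtain ⟨v1, v2, v3, v4, v5, v6, v7, v8, v9, v10, v11, v12, v13, v14, v15, v16, v17, v18, v19⟩ :=
          cert_B1_valid nE ni nj nk nij nik njk nT Z h_nn_E h_nn_0 h_nn_1 h_nn_2 h_nn_01 h_nn_02 h_nn_12 h_nn_T
          h_nn_Z hN2 hB_i hB_j hB_k 
  obtain ⟨w1, w2, w3, w4, w5, w6⟩ :=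
    cert_B1_pairs nE ni nj nk nij nik njk nT Z h_nn_E h_nn_0 h_nn_1 h_nn_2
          h_nn_01 h_nn_02 h_nn_12 h_nn_T h_nn_Z h_sum  
  obtain ⟨x1, x2, x3, x4, x5, x6⟩ :=
    cert_B1_pairsR nE ni nj nk nij nik njk nT Z h_nn_E h_nn_0 h_nn_1 h_nn_2
          h_nn_01 h_nn_02 h_nn_12 h_nn_T h_nn_Z h_sum  
  exact ⟨0, 0, 0, (Z*Z*(nij + nik + njk + nT)),
    v1, v2, v3, v4, v5, v6, v7, v8, v9, v10, v11, v12, v13, v14,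
          v15, v16, v17, v18, v19, w1, w2, w3, w4, w5, w6, x1, x2, x3, x4, x5, x6⟩

/-- **Regime B2(k)** (donors of `k` drained: `r_ik = r_jk = 0`, `r_ij = Z·u·(Z+n_k) − Z(Z+d)B_k`, `r_⊤ = Z(Z+d)B_k
        − Z·u·n_k`), valid when `(Z+d)σ_k ≤ u·n_k` and `r_ij ≥ 0`. [this work] -/
theorem cert_B2 (nE ni nj nk nij nik njk nT Z : ℝ)
    (h_nn_E : 0 ≤ nE) (h_nn_0 : 0 ≤ ni) (h_nn_1 : 0 ≤ nj) (h_nn_2 : 0 ≤ nk) (h_nn_01 : 0 ≤ nij) (h_nn_02 : 0 ≤ nik)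
    (h_nn_12 : 0 ≤ njk) (h_nn_T : 0 ≤ nT) (h_nn_Z : 0 ≤ Z) (h_sum : Z = nE + ni + nj + nk + nij + nik + njk + nT)
    (h_fkg_aa02 : (ni + nij + nik + nT) * (nk + nik + njk + nT) ≤ Z * (nik + nT))
    (h_fkg_aa12 : (nj + nij + njk + nT) * (nk + nik + njk + nT) ≤ Z * (njk + nT))
    (h_fkg_Aa01 : (nij + nT) * (nk + nik + njk + nT) ≤ Z * nT)
    (h_ad_2 : (nij + nik + njk + nT) * nk ≤ (nE + ni + nj + nk) * (nik + njk + nT))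
    (hlam : (Z + (nE + ni + nj + nk)) * (nik + njk) ≤ (nij + nik + njk + nT) * nk)
    (hh : 0 ≤ (nij + nik + njk + nT)*(Z + nk) - (Z + (nE + ni + nj + nk))*(nik + njk + nT)) :
    ∃ rij rik rjk rT : ℝ,
      0 ≤ rij ∧
      0 ≤ rik ∧
      0 ≤ rjk ∧
      0 ≤ rT ∧
      rij ≤ Z * (Z + (nE + ni + nj + nk)) * nij ∧
              rik ≤ Z * (Z + (nE + ni + nj + nk)) * nik ∧
      rjk ≤ Z * (Z + (nE + ni + nj + nk)) * njk ∧
              rT ≤ Z * (Z + (nE + ni + nj + nk)) * nT ∧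
      Z * (nij + nik + njk + nT) * ni ≤
              (Z * (Z + (nE + ni + nj + nk)) * nij - rij) + (Z * (Z + (nE + ni + nj + nk)) * nik - rik) +
              (Z * (Z + (nE + ni + nj + nk)) * nT - rT) ∧
      Z * (nij + nik + njk + nT) * nj ≤
              (Z * (Z + (nE + ni + nj + nk)) * nij - rij) + (Z * (Z + (nE + ni + nj + nk)) * njk - rjk) +
              (Z * (Z + (nE + ni + nj + nk)) * nT - rT) ∧
      Z * (nij + nik + njk + nT) * nk ≤
              (Z * (Z + (nE + ni + nj + nk)) * nik - rik) + (Z * (Z + (nE + ni + nj + nk)) * njk - rjk) +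
              (Z * (Z + (nE + ni + nj + nk)) * nT - rT) ∧
      rij + rik + rjk + rT = Z * Z *
              (nij + nik + njk + nT) ∧
      Z * Z * nT ≤ rT ∧
      Z * Z * (nij + nT) ≤ rij + rT ∧
      Z * Z *
              (nik + nT) ≤ rik + rT ∧
      Z * Z * (njk + nT) ≤ rjk + rT ∧
      Z * Z * (nij + nik + nT) ≤ rij +
              rik + rT ∧
      Z * Z * (nij + njk + nT) ≤ rij + rjk + rT ∧
      Z * Z * (nik + njk + nT) ≤ rik +
              rjk + rT ∧
      Z * ((nij + nT) * (nik + nT) + (nik + nT) * (nij + nT)) - (nij + nik + njk + nT) *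
              (nij + nT) * (nik + nT) ≤ rT ∧
      Z * ((nij + nT) * (njk + nT) + (njk + nT) * (nij + nT)) -
              (nij + nik + njk + nT) * (nij + nT) * (njk + nT) ≤ rT ∧
      Z *
              ((nik + nT) * (njk + nT) + (njk + nT) * (nik + nT)) - (nij + nik + njk + nT) * (nik + nT) *
              (njk + nT) ≤ rT ∧
      Z * ((nij + nT) * (nik + njk + nT) + (nk + nik + njk + nT) * (nij + nT)) -
              (nij + nik + njk + nT) * (nij + nT) * (nk + nik + njk + nT) ≤ rT ∧
      Z *
              ((nik + nT) * (nij + njk + nT) + (nj + nij + njk + nT) * (nik + nT)) - (nij + nik + njk + nT) *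
              (nik + nT) * (nj + nij + njk + nT) ≤ rT ∧
      Z *
              ((njk + nT) * (nij + nik + nT) + (ni + nij + nik + nT) * (njk + nT)) - (nij + nik + njk + nT) *
              (njk + nT) * (ni + nij + nik + nT) ≤ rT ∧
      Z *
              ((ni + nij + nik + nT) * (nij + nik + nT) + (ni + nij + nik + nT) * (nij + nik + nT)) -
              (nij + nik + njk + nT) * (ni + nij + nik + nT) * (ni + nij + nik + nT) ≤ rij + rik + rT ∧
      Z *
              ((nj + nij + njk + nT) * (nij + njk + nT) + (nj + nij + njk + nT) * (nij + njk + nT)) -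
              (nij + nik + njk + nT) * (nj + nij + njk + nT) * (nj + nij + njk + nT) ≤ rij + rjk + rT ∧
      Z *
              ((nk + nik + njk + nT) * (nik + njk + nT) + (nk + nik + njk + nT) * (nik + njk + nT)) -
              (nij + nik + njk + nT) * (nk + nik + njk + nT) * (nk + nik + njk + nT) ≤ rik + rjk + rT ∧
      Z *
              ((ni + nij + nik + nT) * (nij + njk + nT) + (nj + nij + njk + nT) * (nij + nik + nT)) -
              (nij + nik + njk + nT) * (ni + nij + nik + nT) * (nj + nij + njk + nT) ≤ rij + rT ∧
      Z *
              ((ni + nij + nik + nT) * (nik + njk + nT) + (nk + nik + njk + nT) * (nij + nik + nT)) -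
              (nij + nik + njk + nT) * (ni + nij + nik + nT) * (nk + nik + njk + nT) ≤ rik + rT ∧
      Z *
              ((nj + nij + njk + nT) * (nik + njk + nT) + (nk + nik + njk + nT) * (nij + njk + nT)) -
              (nij + nik + njk + nT) * (nj + nij + njk + nT) * (nk + nik + njk + nT) ≤ rjk + rT := by
  obtain ⟨v1, v2, v3, v4, v5, v6, v7, v8, v9, v10, v11, v12, v13, v14, v15, v16, v17, v18, v19⟩ :=
          cert_B2_valid nE ni nj nk nij nik njk nT Z h_nn_E h_nn_0 h_nn_1 h_nn_2 h_nn_01 h_nn_02 h_nn_12 h_nn_T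
          h_nn_Z h_ad_2 hlam hh 
  obtain ⟨w1, w2, w3, w4, w5, w6⟩ :=
    cert_B2_pairs nE ni nj nk nij nik njk nT Z h_nn_E h_nn_0 h_nn_1 h_nn_2
          h_nn_01 h_nn_02 h_nn_12 h_nn_T h_nn_Z h_sum h_fkg_aa02 h_fkg_aa12 h_fkg_Aa01 h_ad_2  
  obtain ⟨x1, x2, x3, x4, x5, x6⟩ :=
    cert_B2_pairsR nE ni nj nk nij nik njk nT Z h_nn_E h_nn_0 h_nn_1 h_nn_2
          h_nn_01 h_nn_02 h_nn_12 h_nn_T h_nn_Z h_sum h_fkg_aa02 h_fkg_aa12 h_ad_2  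
  exact ⟨(Z*(nij + nik + njk + nT)*(Z + nk) - Z*(Z + (nE + ni + nj + nk))*(nik + njk + nT)), 0, 0,
          (Z*(Z + (nE + ni + nj + nk))*(nik + njk + nT) - Z*(nij + nik + njk + nT)*nk),
    v1, v2, v3, v4, v5, v6,
          v7, v8, v9, v10, v11, v12, v13, v14, v15, v16, v17, v18, v19, w1, w2, w3, w4, w5, w6, x1, x2, x3, x4, x5,
          x6⟩

end Summit.CriticalPhenomena.PercolationContinuityZ3.Theorems.SahiE3MajCert
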